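import Literature.AlgebraicGeometry.HodgeTheory.QuarticCMTwoOneSlotsHodgeClasses
import HarnessLib

/-!
# `Hg = U_E` (E a CM field) ⟹ the Hodge classes on all powers are generated by divisor classes, II: adapted `ψ_ℂ`-dual bases of `H¹ ⊗ ℂ = ⊕_σ H¹_σ` for a CM structure `E = ℚ[φ]` of any degree and any multiplicities (Deligne LNM 900 §4; Moonen–Zarhin 1999 §1, (2.3))

Family `hodge`, layer `Literature/AlgebraicGeometry/HodgeTheory`. Research context: cell `pub-hodgeav-hg6` (LADDER-HodgeAV
PERC-SHAPE row 2, «base of HC ladder», req-37 Q2b TABLE X; HONEST FRAMING: nothing here proves HC, HC_AV or HC_CM; not a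
corollary). UNCONDITIONAL linear algebra of polarized weight-one `ℚ`-Hodge structures; theorems only, no definition, no
named fact (D-0026), no `sorry`. Part II of the coloured socket (part I `CMHodgeGroupSlotsHodgeClasses`; sequel
`CMHodgeGroupPowersHodgeClasses`).

The tree's `HodgeStructure.QuarticTheta.exists_adaptedDualBasis` (`QuarticCMTwoOneSlotsHodgeClasses` §2) builds adapted
dual bases for a QUARTIC CM structure of multiplicities `{(1,1),(2,0)}` on `dim V = 8` by an explicit dimension count
(`QuarticTheta.eigenspace_facts`). This file does it for `E = ℚ[φ] ⊆ End_Hdg(V)` of ANY degree `2|ι|` and ANY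
multiplicities, from two hypotheses that the geometric sequel discharges by counting: `hrank` (the two graded pieces of
`W_{μ k}` have total dimension `n₀ = dim_E V`, the same for every colour `k`) and `htop` (the `2|ι|` eigenspaces
`W_{μ k}`, `W_{conj μ k}` span `V_ℂ`).
* §1 `CMTheta.exists_smul_of_mem_endAlg` (`E = ℚ[φ]` acts on each `W_c` by scalars; the tree's `QuarticTheta.…` with
  `Fin 4 ↦ Fin m`), `CMTheta.form_eq_zero_of_ne` (the Rosati involution is complex conjugation on `E`:
  `ψ_ℂ(W_a, W_b) = 0` unless `b = conj a`; the tree's `QuarticTheta.form_eq_zero_of_ne` with `Fin 4 ↦ Fin m` and the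
  hypothesis `W_b ≠ ⊥` removed).
* §2 `CMTheta.exists_adaptedDualBasis` — a basis `cb ((k,t),ℓ)` (`k : ι` colour, `t` type, `ℓ : Fin n₀`) of `V_ℂ` and kinds
  `κ (k,ℓ)` with `cb((k,0),ℓ) ∈ W_{μ k}`, `cb((k,1),ℓ) ∈ W_{conj μ k}`, pure Hodge types (opposite for the two types),
  `ψ_ℂ(cb((k,0),i), cb((k',1),j)) = δ_{kk'}δ_{ij}` and `ψ_ℂ = 0` on two letters of the same type: per colour, bases of
  `W_{μ k} ∩ V^{1,0}`, `W_{μ k} ∩ V^{0,1}` and their `ψ_ℂ`-dual bases of `W_{conj μ k} ∩ V^{0,1}`, `W_{conj μ k} ∩ V^{1,0}`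
  (`QuarticTheta.pairing_bijective`, any eigenvalue); independence by the pairing table, spanning by `htop` and the
  `Θ`-grading. (Deligne §4: `H¹ ⊗ ℂ = ⊕_σ H¹_σ`, `ψ` pairs `H¹_σ` with `H¹_σ̄`; MZ99 §1: `n_σ + n_σ̄ = dim_E V`; Milne §2:
  «the standard representation and its contragredient», per place.) The skeleton is that of the tree's one-colour
  `UnitaryTheta.exists_adaptedDualBasis` (credited).

## References

* [Deligne1982HodgeCycles] P. Deligne, *Hodge cycles on abelian varieties*, LNM 900 (1982), §4 (p. 30).
* [MoonenZarhin1999LowDim] B. Moonen, Yu. Zarhin, Math. Ann. 315 (1999) = arXiv:math/9901113, §1, §2 (2.3).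
* [MumfordAV1970] D. Mumford, *Abelian Varieties* (1970), §21 (the Rosati involution of a CM field).
* [Milne1999LefschetzClasses] J. S. Milne, Duke Math. J. 96 (1999), §2 p. 651.
* [VoisinHodgeI2002] C. Voisin, *Hodge Theory and Complex Algebraic Geometry I*, §7.1.2 Def. 7.7.
* [Gordon1997] B. B. Gordon, arXiv:alg-geom/9709030, §6 (proof of Thm. 6.3.3, p. 19).
-/

noncomputable section

open scoped TensorProduct
open Module

namespace Literature.AlgebraicGeometry.Motives

namespace HodgeStructure

section CMDualBases

universe u

variable {V : Type u} [AddCommGroup V] [Module ℚ V] {n : ℤ}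

/-! ### §1 `E = ℚ[φ]` of any degree: scalars on eigenspaces and orthogonality of non-conjugate eigenspaces -/

/-- Rational scalars act on `V_ℂ` through `ℚ ⊆ ℂ`. [folklore] -/
private theorem CMTheta.ratCast_smul (q : ℚ) (z : ℂ ⊗[ℚ] V) : (q : ℂ) • z = q • z := by
  rw [← algebraMap_smul ℂ q z, eq_ratCast]

/-- The two elements of `Fin 2`. [folklore] -/
private theorem CMTheta.fin2_cases (r : Fin 2) : r = 0 ∨ r = 1 := by
  fin_cases r <;> simp

/-- **`E = ℚ[φ]` (any degree `m`) acts on each eigenspace `W_c` of `φ_ℂ` by scalars**: for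
`a = Σ_{k<m} q_k φ^k ∈ End_Hdg(V)`, `a_ℂ|_{W_c} = Σ_k q_k c^k` (the tree's `QuarticTheta.exists_smul_of_mem_endAlg` with
`Fin 4 ↦ Fin m`; Deligne §4: `E ⊗ ℂ = ℂ^{Hom(E,ℂ)}` acts on `H¹_σ` through `σ`). [cite: Deligne1982HodgeCycles, §4 (p. 30)] -/
theorem CMTheta.exists_smul_of_mem_endAlg (H : HodgeStructure V n) {φ : Module.End ℚ V} {m : ℕ}
    (hE : ∀ a ∈ H.endAlg, ∃ q : Fin m → ℚ, a = ∑ k, q k • φ ^ (k : ℕ)) {a : Module.End ℚ V}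
    (ha : a ∈ H.endAlg) (c : ℂ) :
    ∃ s : ℂ, ∀ w ∈ Module.End.eigenspace (φ.baseChange ℂ) c, a.baseChange ℂ w = s • w := by
  obtain ⟨q, rfl⟩ := hE a ha
  refine ⟨∑ k, (q k : ℂ) * c ^ (k : ℕ), fun w hw => ?_⟩
  rw [Finset.sum_smul]
  have h : ∀ s : Finset (Fin m), (∑ k ∈ s, q k • φ ^ (k : ℕ)).baseChange ℂ w =
      ∑ k ∈ s, ((q k : ℂ) * c ^ (k : ℕ)) • w := by
    intro s
    induction s using Finset.induction_on with
    | empty => rw [Finset.sum_empty, Finset.sum_empty, LinearMap.baseChange_zero, LinearMap.zero_apply]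
    | insert k s hk ih =>
      rw [Finset.sum_insert hk, Finset.sum_insert hk, LinearMap.baseChange_add, LinearMap.add_apply, ih,
        LinearMap.baseChange_smul, LinearMap.smul_apply, QuarticTheta.baseChange_pow_apply φ hw,
        ← CMTheta.ratCast_smul, smul_smul]
  exact h Finset.univ

/-- **The Rosati involution is complex conjugation on `E = ℚ[φ]` (any degree): `ψ_ℂ(W_a, W_b) = 0` unless `b = conj a`.**
The adjoint `φ† ∈ End_Hdg = ℚ[φ]` acts on `W_b` by a scalar `s`, and `ψ_ℂ(φ_ℂ x, y) = ψ_ℂ(x, φ†_ℂ y)` gives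
`(a - s) ψ_ℂ(x, y) = 0` for `x ∈ W_a`, `y ∈ W_b`; testing on `x = conj z`, `0 ≠ z ∈ W_b` of pure Hodge type (`W_b` is
`Θ`-graded; `ψ_ℂ(conj z, z) ≠ 0` by the second Hodge–Riemann relation) gives `s = conj b` (the tree's
`QuarticTheta.form_eq_zero_of_ne` for `Fin m`, the case `W_b = 0` being trivial). Mumford §21: the Rosati involution of a
CM field is complex conjugation. [cite: MumfordAV1970, §21] [cite: Deligne1982HodgeCycles, §4 (p. 30)]
[cite: VoisinHodgeI2002, §7.1.2 Def. 7.7] -/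
theorem CMTheta.form_eq_zero_of_ne [Module.Finite ℚ V] [HodgeTensorFacts.{u, u}] (H : HodgeStructure V n)
    (hn : n = 1) (heff : H.IsEffective) (ψ : H.Polarization) {φ : Module.End ℚ V} (hφE : φ ∈ H.endAlg) {m : ℕ}
    (hE : ∀ a ∈ H.endAlg, ∃ q : Fin m → ℚ, a = ∑ k, q k • φ ^ (k : ℕ)) {a b : ℂ} (hab : a ≠ starRingEnd ℂ b)
    {x y : ℂ ⊗[ℚ] V} (hx : x ∈ Module.End.eigenspace (φ.baseChange ℂ) a)
    (hy : y ∈ Module.End.eigenspace (φ.baseChange ℂ) b) : ψ.form.baseChange ℂ x y = 0 := by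
  by_cases hb : Module.End.eigenspace (φ.baseChange ℂ) b = ⊥
  · rw [hb, Submodule.mem_bot] at hy
    rw [hy, map_zero]
  obtain ⟨Θ, hΘ⟩ := exists_hodgeTheta H
  have hΘφ : Θ * φ.baseChange ℂ = φ.baseChange ℂ * Θ :=
    commute_baseChange_of_mem_hodgeLieC H (H.mem_hodgeLieC_of_forall_piece hΘ) ⟨φ, hφE⟩
  obtain ⟨hP, hQ, hΘ10, hΘ01, -⟩ := UnitaryTheta.theta_facts H hn heff hΘ
  subst hn
  set ψC := ψ.form.baseChange ℂ with hψC
  -- `φ†` acts on `W_b` by a scalar `s`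
  obtain ⟨s, hs⟩ := CMTheta.exists_smul_of_mem_endAlg H hE (ψ.adjoint_mem_endAlg hφE) b
  have key : ∀ a' x' y', x' ∈ Module.End.eigenspace (φ.baseChange ℂ) a' →
      y' ∈ Module.End.eigenspace (φ.baseChange ℂ) b → (a' - s) * ψC x' y' = 0 := by
    intro a' x' y' hx' hy'
    have h1 : ψC (φ.baseChange ℂ x') y' = a' * ψC x' y' := by
      rw [Module.End.mem_eigenspace_iff.1 hx', LinearMap.map_smul₂, smul_eq_mul]
    have h2 : ψC (φ.baseChange ℂ x') y' = s * ψC x' y' := by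
      rw [hψC, isAdjointPair_baseChange (ψ.isAdjointPair_adjoint φ) x' y', hs y' hy', map_smul, smul_eq_mul]
    linear_combination h2 - h1
  -- `s = conj b`: test against a non-zero vector of pure type in `W_b`
  have hsb : s = starRingEnd ℂ b := by
    obtain ⟨z, hz, hz0⟩ := (Submodule.ne_bot_iff _).1 hb
    have hΘz : Θ z ∈ Module.End.eigenspace (φ.baseChange ℂ) b :=
      UnitaryTheta.apply_mem_eigenspace_of_commute hΘφ hz
    have hPz : (2 : ℂ)⁻¹ • (z + Θ z) ∈ Module.End.eigenspace (φ.baseChange ℂ) b :=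
      Submodule.smul_mem _ _ (Submodule.add_mem _ hz hΘz)
    have hQz : (2 : ℂ)⁻¹ • (z - Θ z) ∈ Module.End.eigenspace (φ.baseChange ℂ) b :=
      Submodule.smul_mem _ _ (Submodule.sub_mem _ hz hΘz)
    have hPQ : (2 : ℂ)⁻¹ • (z + Θ z) + (2 : ℂ)⁻¹ • (z - Θ z) = z := by module
    have htest : ∀ (p q : ℤ) (z₀ : ℂ ⊗[ℚ] V), p + q = 1 → z₀ ∈ H.piece p q →
        z₀ ∈ Module.End.eigenspace (φ.baseChange ℂ) b → z₀ ≠ 0 → s = starRingEnd ℂ b := by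
      intro p q z₀ hpq hz₀ hz₀b hz₀0
      have hcz : conj z₀ ∈ Module.End.eigenspace (φ.baseChange ℂ) (starRingEnd ℂ b) := by
        rw [← EndAction.complexConj_eigenspace_baseChange, mem_complexConj, conj_conj]
        exact hz₀b
      have hne : ψC (conj z₀) z₀ ≠ 0 := by
        have h := ψ.form_conj_ne_zero (by rw [← hpq, add_comm]) (H.conj_mem_piece hz₀)
          (fun h => hz₀0 (by rw [← conj_conj z₀, h, map_zero]))
        rwa [conj_conj] at h
      have h := key _ _ _ hcz hz₀b
      rcases mul_eq_zero.1 h with h | h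
      · exact (sub_eq_zero.1 h).symm
      · exact absurd h hne
    by_cases hP0 : (2 : ℂ)⁻¹ • (z + Θ z) = 0
    · have hQ0 : (2 : ℂ)⁻¹ • (z - Θ z) ≠ 0 := by
        intro hQ0
        exact hz0 (by rw [← hPQ, hP0, hQ0, add_zero])
      exact htest 0 1 _ (by norm_num) (hQ z) hQz hQ0
    · exact htest 1 0 _ (by norm_num) (hP z) hPz hP0
  have h := key a x y hx hy
  rw [hsb] at h
  rcases mul_eq_zero.1 h with h | h
  · exact absurd (sub_eq_zero.1 h) hab
  · exact h

/-! ### §2 Adapted `ψ_ℂ`-dual bases of `V_ℂ = ⊕_k (W_{μ k} ⊕ W_{conj μ k})` -/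

/-- **Adapted `ψ_ℂ`-dual bases for a CM structure `E = ℚ[φ] ⊆ End_Hdg(V)` of any degree and any multiplicities.** Data:
`H` effective polarized of weight `1`; `φ ∈ End_Hdg(V)` with `End_Hdg(V) = Σ_{k<m} ℚφ^k`; colours `μ : ι → ℂ` (one
eigenvalue of `φ_ℂ` per pair of conjugate places) with `μ` injective and NO `μ k'` conjugate to a `μ k`; `hrank`:
`dim(W_{μ k} ∩ V^{1,0}) + dim(W_{μ k} ∩ V^{0,1}) = n₀` for every `k`; `htop`: the `2|ι|` eigenspaces `W_{μ k}`, `W_{conj μ k}`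
span `V_ℂ`. Then there are a basis `cb ((k,t),ℓ)` of `V_ℂ` and kinds `κ (k,ℓ)` with `cb((k,0),ℓ) ∈ W_{μ k}`,
`cb((k,1),ℓ) ∈ W_{conj μ k}`, `cb((k,0),ℓ) ∈ V^{1,0}, cb((k,1),ℓ) ∈ V^{0,1}` for `κ = 0` and the opposite types for `κ = 1`,
`ψ_ℂ(cb((k,0),i), cb((k',1),j)) = δ_{kk'} δ_{ij}` and `ψ_ℂ = 0` on two letters of the same type. Construction per colour:
bases of `W_{μ k} ∩ V^{1,0}`, `W_{μ k} ∩ V^{0,1}` and their dual bases of `W_{conj μ k} ∩ V^{0,1}`, `W_{conj μ k} ∩ V^{1,0}`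
(`QuarticTheta.pairing_bijective`); vanishing of all other pairings by `CMTheta.form_eq_zero_of_ne`; independence by the
pairing table; spanning by `htop` and the `Θ`-grading. In these letters every `Y ∈ 𝔲_E(V,ψ)_ℂ = ∏_k 𝔤𝔩(W_{μ k})` has matrix
`⊕_k (X_k ⊕ -X_kᵀ)`. (Skeleton of the tree's `UnitaryTheta.exists_adaptedDualBasis`, one colour.)
[cite: Deligne1982HodgeCycles, §4 (p. 30)] [cite: MoonenZarhin1999LowDim, §1 and §2 (2.3)]
[cite: Milne1999LefschetzClasses, §2 p. 651] [cite: Gordon1997, §6 (proof of Thm. 6.3.3, p. 19)] -/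
theorem CMTheta.exists_adaptedDualBasis [Module.Finite ℚ V] [HodgeTensorFacts.{u, u}] {ι : Type} [Fintype ι]
    [DecidableEq ι] (H : HodgeStructure V n) (hn : n = 1) (heff : H.IsEffective) (ψ : H.Polarization)
    {φ : Module.End ℚ V} (hφE : φ ∈ H.endAlg) {m : ℕ}
    (hE : ∀ a ∈ H.endAlg, ∃ q : Fin m → ℚ, a = ∑ k, q k • φ ^ (k : ℕ)) (μ : ι → ℂ)
    (hinj : Function.Injective μ) (hdist : ∀ k k', μ k' ≠ starRingEnd ℂ (μ k)) {n₀ : ℕ}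
    (hrank : ∀ k, Module.finrank ℂ ↥(Module.End.eigenspace (φ.baseChange ℂ) (μ k) ⊓ H.piece 1 0) +
      Module.finrank ℂ ↥(Module.End.eigenspace (φ.baseChange ℂ) (μ k) ⊓ H.piece 0 1) = n₀)
    (htop : (⨆ kt : ι × Fin 2, Module.End.eigenspace (φ.baseChange ℂ)
      (if kt.2 = 0 then μ kt.1 else starRingEnd ℂ (μ kt.1))) = ⊤) :
    ∃ (cb : Module.Basis ((ι × Fin 2) × Fin n₀) ℂ (ℂ ⊗[ℚ] V)) (κ : ι × Fin n₀ → Fin 2),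
      (∀ k ℓ, cb ((k, 0), ℓ) ∈ Module.End.eigenspace (φ.baseChange ℂ) (μ k)) ∧
      (∀ k ℓ, cb ((k, 1), ℓ) ∈ Module.End.eigenspace (φ.baseChange ℂ) (starRingEnd ℂ (μ k))) ∧
      (∀ k ℓ, κ (k, ℓ) = 0 → cb ((k, 0), ℓ) ∈ H.piece 1 0 ∧ cb ((k, 1), ℓ) ∈ H.piece 0 1) ∧
      (∀ k ℓ, κ (k, ℓ) = 1 → cb ((k, 0), ℓ) ∈ H.piece 0 1 ∧ cb ((k, 1), ℓ) ∈ H.piece 1 0) ∧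
      (∀ k k' i j, ψ.form.baseChange ℂ (cb ((k, 0), i)) (cb ((k', 1), j)) =
        if k = k' ∧ i = j then 1 else 0) ∧
      (∀ k k' (t : Fin 2) i j, ψ.form.baseChange ℂ (cb ((k, t), i)) (cb ((k', t), j)) = 0) := by
  classical
  -- orthogonality of non-conjugate eigenspaces (`E = ℚ[φ]`)
  have hperp : ∀ {a b : ℂ}, a ≠ starRingEnd ℂ b → ∀ {x y : ℂ ⊗[ℚ] V},
      x ∈ Module.End.eigenspace (φ.baseChange ℂ) a → y ∈ Module.End.eigenspace (φ.baseChange ℂ) b →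
      ψ.form.baseChange ℂ x y = 0 := fun hab _ _ hx hy =>
    CMTheta.form_eq_zero_of_ne H hn heff ψ hφE hE hab hx hy
  subst hn
  obtain ⟨Θ, hΘ⟩ := exists_hodgeTheta H
  obtain ⟨hP, hQ, hΘ10, hΘ01, -⟩ := UnitaryTheta.theta_facts H rfl heff hΘ
  set φC := φ.baseChange ℂ with hφC
  set ψC := ψ.form.baseChange ℂ with hψC
  have hΘφ : Θ * φC = φC * Θ :=
    commute_baseChange_of_mem_hodgeLieC H (H.mem_hodgeLieC_of_forall_piece hΘ) ⟨φ, hφE⟩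
  have hΘW : ∀ c, ∀ w ∈ Module.End.eigenspace φC c, Θ w ∈ Module.End.eigenspace φC c := fun c w hw =>
    UnitaryTheta.apply_mem_eigenspace_of_commute hΘφ hw
  have hswap : ∀ x y, ψC y x = -ψC x y := fun x y => by
    rw [hψC, ψ.form_baseChange_swap, show (1 : ℤ).negOnePow = -1 from Int.negOnePow_one]
    simp
  have h1100 : ∀ x ∈ H.piece 1 0, ∀ y ∈ H.piece 1 0, ψC x y = 0 := fun x hx y hy =>
    ψ.form_piece_piece (p := 1) (p' := 1) (by norm_num) (by simpa using hx) (by simpa using hy)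
  have h0101 : ∀ x ∈ H.piece 0 1, ∀ y ∈ H.piece 0 1, ψC x y = 0 := fun x hx y hy =>
    ψ.form_piece_piece (p := 0) (p' := 0) (by norm_num) (by simpa using hx) (by simpa using hy)
  -- the graded pieces of each colour and their bases
  set W₁ : ι → Submodule ℂ (ℂ ⊗[ℚ] V) := fun k => Module.End.eigenspace φC (μ k) ⊓ H.piece 1 0 with hW₁def
  set L : ι → Submodule ℂ (ℂ ⊗[ℚ] V) := fun k => Module.End.eigenspace φC (μ k) ⊓ H.piece 0 1 with hLdef
  set W₁' : ι → Submodule ℂ (ℂ ⊗[ℚ] V) := fun k =>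
    Module.End.eigenspace φC (starRingEnd ℂ (μ k)) ⊓ H.piece 0 1 with hW₁'def
  set L' : ι → Submodule ℂ (ℂ ⊗[ℚ] V) := fun k =>
    Module.End.eigenspace φC (starRingEnd ℂ (μ k)) ⊓ H.piece 1 0 with hL'def
  set a : ι → ℕ := fun k => Module.finrank ℂ ↥(W₁ k) with hadef
  set b : ι → ℕ := fun k => Module.finrank ℂ ↥(L k) with hbdef
  have hab : ∀ k, a k + b k = n₀ := fun k => hrank k
  set b₁ : ∀ k, Module.Basis (Fin (a k)) ℂ ↥(W₁ k) := fun k => Module.finBasis ℂ ↥(W₁ k) with hb₁def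
  set b₂ : ∀ k, Module.Basis (Fin (b k)) ℂ ↥(L k) := fun k => Module.finBasis ℂ ↥(L k) with hb₂def
  set Φ₁ : ∀ k, ↥(W₁' k) ≃ₗ[ℂ] Module.Dual ℂ ↥(W₁ k) := fun k =>
    LinearEquiv.ofBijective _ (QuarticTheta.pairing_bijective H rfl ψ φ (μ k) 1 0 (by norm_num)) with hΦ₁def
  set Φ₂ : ∀ k, ↥(L' k) ≃ₗ[ℂ] Module.Dual ℂ ↥(L k) := fun k =>
    LinearEquiv.ofBijective _ (QuarticTheta.pairing_bijective H rfl ψ φ (μ k) 0 1 (by norm_num)) with hΦ₂def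
  have hΦ₁ : ∀ k (y' : ↥(W₁' k)) (x : ↥(W₁ k)), Φ₁ k y' x = ψC x y' := fun k y' x => by
    rw [hΦ₁def, LinearEquiv.ofBijective_apply, LinearMap.flip_apply, LinearMap.domRestrict₁₂_apply]
  have hΦ₂ : ∀ k (y' : ↥(L' k)) (x : ↥(L k)), Φ₂ k y' x = ψC x y' := fun k y' x => by
    rw [hΦ₂def, LinearEquiv.ofBijective_apply, LinearMap.flip_apply, LinearMap.domRestrict₁₂_apply]
  set fb₁ : ∀ k, Module.Basis (Fin (a k)) ℂ ↥(W₁' k) := fun k => (b₁ k).dualBasis.map (Φ₁ k).symm with hfb₁def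
  set fb₂ : ∀ k, Module.Basis (Fin (b k)) ℂ ↥(L' k) := fun k => (b₂ k).dualBasis.map (Φ₂ k).symm with hfb₂def
  have hfb₁ : ∀ k i (x : ↥(W₁ k)), ψC x (fb₁ k i) = (b₁ k).repr x i := fun k i x => by
    rw [← hΦ₁, hfb₁def, Module.Basis.map_apply, LinearEquiv.apply_symm_apply, Module.Basis.dualBasis_apply]
  have hfb₂ : ∀ k i (x : ↥(L k)), ψC x (fb₂ k i) = (b₂ k).repr x i := fun k i x => by
    rw [← hΦ₂, hfb₂def, Module.Basis.map_apply, LinearEquiv.apply_symm_apply, Module.Basis.dualBasis_apply]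
  -- the letters of colour `k`, indexed by `Fin (a k) ⊕ Fin (b k)`
  set e : ∀ k, Fin (a k) ⊕ Fin (b k) → ℂ ⊗[ℚ] V := fun k =>
    Sum.elim (fun i => (b₁ k i : ℂ ⊗[ℚ] V)) (fun j => (b₂ k j : ℂ ⊗[ℚ] V)) with hedef
  set f : ∀ k, Fin (a k) ⊕ Fin (b k) → ℂ ⊗[ℚ] V := fun k =>
    Sum.elim (fun i => (fb₁ k i : ℂ ⊗[ℚ] V)) (fun j => (fb₂ k j : ℂ ⊗[ℚ] V)) with hfdef
  set κ₀ : ∀ k, Fin (a k) ⊕ Fin (b k) → Fin 2 := fun k => Sum.elim (fun _ => 0) (fun _ => 1) with hκ₀def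
  have heW : ∀ k s, e k s ∈ Module.End.eigenspace φC (μ k) := by
    rintro k (i | j); exacts [(b₁ k i).2.1, (b₂ k j).2.1]
  have hfW' : ∀ k s, f k s ∈ Module.End.eigenspace φC (starRingEnd ℂ (μ k)) := by
    rintro k (i | j); exacts [(fb₁ k i).2.1, (fb₂ k j).2.1]
  have he0 : ∀ k s, κ₀ k s = 0 → e k s ∈ H.piece 1 0 ∧ f k s ∈ H.piece 0 1 := by
    rintro k (i | j) h
    · exact ⟨(b₁ k i).2.2, (fb₁ k i).2.2⟩
    · simp [hκ₀def] at h
  have he1 : ∀ k s, κ₀ k s = 1 → e k s ∈ H.piece 0 1 ∧ f k s ∈ H.piece 1 0 := by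
    rintro k (i | j) h
    · simp [hκ₀def] at h
    · exact ⟨(b₂ k j).2.2, (fb₂ k j).2.2⟩
  have hdual₀ : ∀ k s s', ψC (e k s) (f k s') = if s = s' then 1 else 0 := by
    rintro k (i | i) (j | j)
    · change ψC (b₁ k i : ℂ ⊗[ℚ] V) (fb₁ k j) = _
      rw [hfb₁, Module.Basis.repr_self, Finsupp.single_apply]
      by_cases h : i = j
      · subst h; simp
      · rw [if_neg h, if_neg (fun h' => h (Sum.inl_injective h'))]
    · change ψC (b₁ k i : ℂ ⊗[ℚ] V) (fb₂ k j) = _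
      rw [h1100 _ (b₁ k i).2.2 _ (fb₂ k j).2.2, if_neg Sum.inl_ne_inr]
    · change ψC (b₂ k i : ℂ ⊗[ℚ] V) (fb₁ k j) = _
      rw [h0101 _ (b₂ k i).2.2 _ (fb₁ k j).2.2, if_neg Sum.inr_ne_inl]
    · change ψC (b₂ k i : ℂ ⊗[ℚ] V) (fb₂ k j) = _
      rw [hfb₂, Module.Basis.repr_self, Finsupp.single_apply]
      by_cases h : i = j
      · subst h; simp
      · rw [if_neg h, if_neg (fun h' => h (Sum.inr_injective h'))]
  -- the combined family, indexed by `(ι × Fin 2) × Fin n₀` through `σ k : Fin (a k) ⊕ Fin (b k) ≃ Fin n₀`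
  set σ : ∀ k, Fin (a k) ⊕ Fin (b k) ≃ Fin n₀ := fun k => finSumFinEquiv.trans (finCongr (hab k)) with hσdef
  set cbf : (ι × Fin 2) × Fin n₀ → ℂ ⊗[ℚ] V := fun x =>
    if x.1.2 = 0 then e x.1.1 ((σ x.1.1).symm x.2) else f x.1.1 ((σ x.1.1).symm x.2) with hcbfdef
  have hcbf0 : ∀ k ℓ, cbf ((k, 0), ℓ) = e k ((σ k).symm ℓ) := fun k ℓ => by simp [hcbfdef]
  have hcbf1 : ∀ k ℓ, cbf ((k, 1), ℓ) = f k ((σ k).symm ℓ) := fun k ℓ => by simp [hcbfdef]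
  -- the pairing table
  have hT01 : ∀ k k' i j, ψC (cbf ((k, 0), i)) (cbf ((k', 1), j)) = if k = k' ∧ i = j then 1 else 0 := by
    intro k k' i j
    rw [hcbf0, hcbf1]
    by_cases hkk : k = k'
    · subst hkk
      rw [hdual₀]
      by_cases hij : i = j
      · subst hij; simp
      · rw [if_neg (fun h => hij ((σ k).symm.injective h)), if_neg (fun h => hij h.2)]
    · rw [if_neg (fun h => hkk h.1)]
      refine hperp ?_ (heW _ _) (hfW' _ _)
      rw [starRingEnd_self_apply]
      exact hinj.ne hkk
  have hT00 : ∀ k k' i j, ψC (cbf ((k, 0), i)) (cbf ((k', 0), j)) = 0 := fun k k' i j => by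
    rw [hcbf0, hcbf0]
    exact hperp (hdist k' k) (heW _ _) (heW _ _)
  have hT11 : ∀ k k' i j, ψC (cbf ((k, 1), i)) (cbf ((k', 1), j)) = 0 := fun k k' i j => by
    rw [hcbf1, hcbf1]
    refine hperp ?_ (hfW' _ _) (hfW' _ _)
    rw [starRingEnd_self_apply]
    exact (hdist k k').symm
  have hcolumn : ∀ x k ℓ, ψC (cbf x) (cbf ((k, 1), ℓ)) = if x = ((k, 0), ℓ) then 1 else 0 := by
    rintro ⟨⟨k', t⟩, i⟩ k ℓ
    rcases CMTheta.fin2_cases t with rfl | rfl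
    · rw [hT01]
      by_cases h : k' = k ∧ i = ℓ
      · rw [if_pos h, if_pos (by rw [h.1, h.2])]
      · rw [if_neg h, if_neg (fun h' => h (by
          simp only [Prod.mk.injEq] at h'
          exact ⟨h'.1.1, h'.2⟩))]
    · rw [hT11, if_neg (fun h' => by simp [Prod.mk.injEq] at h')]
  have hrow : ∀ x k ℓ, ψC (cbf ((k, 0), ℓ)) (cbf x) = if x = ((k, 1), ℓ) then 1 else 0 := by
    rintro ⟨⟨k', t⟩, i⟩ k ℓ
    rcases CMTheta.fin2_cases t with rfl | rfl
    · rw [hT00, if_neg (fun h' => by simp [Prod.mk.injEq] at h')]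
    · rw [hT01]
      by_cases h : k = k' ∧ ℓ = i
      · rw [if_pos h, if_pos (by rw [h.1, h.2])]
      · rw [if_neg h, if_neg (fun h' => h (by
          simp only [Prod.mk.injEq] at h'
          exact ⟨h'.1.1.symm, h'.2.symm⟩))]
  -- linear independence by the pairing table
  have hli : LinearIndependent ℂ cbf := by
    rw [Fintype.linearIndependent_iff]
    intro c hc
    rintro ⟨⟨k, t⟩, ℓ⟩
    rcases CMTheta.fin2_cases t with rfl | rfl
    · have h := congrArg (fun z => ψC z (cbf ((k, 1), ℓ))) hc
      simp only [map_sum, map_smul, LinearMap.sum_apply, LinearMap.smul_apply, smul_eq_mul, hcolumn,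
        mul_ite, mul_one, mul_zero, Finset.sum_ite_eq', Finset.mem_univ, if_true, map_zero,
        LinearMap.zero_apply] at h
      exact h
    · have h := congrArg (fun z => ψC (cbf ((k, 0), ℓ)) z) hc
      simp only [map_sum, map_smul, smul_eq_mul, hrow, mul_ite, mul_one, mul_zero, Finset.sum_ite_eq',
        Finset.mem_univ, if_true, map_zero] at h
      exact h
  -- spanning: `V_ℂ = ⊕_k (W_{μ k} ⊕ W_{conj μ k})` (`htop`) and each `W_c` is `Θ`-graded
  have hspan : ⊤ ≤ Submodule.span ℂ (Set.range cbf) := by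
    rintro v -
    have hsub : ∀ (S : Submodule ℂ (ℂ ⊗[ℚ] V)) {ι' : Type} [Fintype ι'] (bS : Module.Basis ι' ℂ S)
        (emb : ι' → (ι × Fin 2) × Fin n₀) (hemb : ∀ i, cbf (emb i) = bS i) (x : ℂ ⊗[ℚ] V) (hx : x ∈ S),
        x ∈ Submodule.span ℂ (Set.range cbf) := by
      intro S ι' _ bS emb hemb x hx
      have h := congrArg Subtype.val (bS.sum_repr ⟨x, hx⟩)
      simp only [Submodule.coe_sum, Submodule.coe_smul] at h
      rw [← h]
      refine Submodule.sum_mem _ fun i _ => Submodule.smul_mem _ _ ?_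
      rw [← hemb]
      exact Submodule.subset_span ⟨emb i, rfl⟩
    have hv : v ∈ ⨆ kt : ι × Fin 2, Module.End.eigenspace φC
        (if kt.2 = 0 then μ kt.1 else starRingEnd ℂ (μ kt.1)) := by
      rw [htop]; exact Submodule.mem_top
    refine Submodule.iSup_induction _ (motive := fun x => x ∈ Submodule.span ℂ (Set.range cbf)) hv
      (fun kt w hw => ?_) (Submodule.zero_mem _) (fun x y hx hy => Submodule.add_mem _ hx hy)
    obtain ⟨k, t⟩ := kt
    have hw_eq : w = (2 : ℂ)⁻¹ • (w + Θ w) + (2 : ℂ)⁻¹ • (w - Θ w) := by module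
    rcases CMTheta.fin2_cases t with rfl | rfl
    · have hw' : w ∈ Module.End.eigenspace φC (μ k) := by simpa using hw
      have hPw : (2 : ℂ)⁻¹ • (w + Θ w) ∈ W₁ k :=
        ⟨Submodule.smul_mem _ _ (Submodule.add_mem _ hw' (hΘW _ w hw')), hP w⟩
      have hQw : (2 : ℂ)⁻¹ • (w - Θ w) ∈ L k :=
        ⟨Submodule.smul_mem _ _ (Submodule.sub_mem _ hw' (hΘW _ w hw')), hQ w⟩
      rw [hw_eq]
      refine Submodule.add_mem _ ?_ ?_
      · exact hsub (W₁ k) (b₁ k) (fun i => ((k, 0), σ k (Sum.inl i)))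
          (fun i => by rw [hcbf0, Equiv.symm_apply_apply]; rfl) _ hPw
      · exact hsub (L k) (b₂ k) (fun j => ((k, 0), σ k (Sum.inr j)))
          (fun j => by rw [hcbf0, Equiv.symm_apply_apply]; rfl) _ hQw
    · have hw' : w ∈ Module.End.eigenspace φC (starRingEnd ℂ (μ k)) := by simpa using hw
      have hPw : (2 : ℂ)⁻¹ • (w + Θ w) ∈ L' k :=
        ⟨Submodule.smul_mem _ _ (Submodule.add_mem _ hw' (hΘW _ w hw')), hP w⟩
      have hQw : (2 : ℂ)⁻¹ • (w - Θ w) ∈ W₁' k :=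
        ⟨Submodule.smul_mem _ _ (Submodule.sub_mem _ hw' (hΘW _ w hw')), hQ w⟩
      rw [hw_eq]
      refine Submodule.add_mem _ ?_ ?_
      · exact hsub (L' k) (fb₂ k) (fun j => ((k, 1), σ k (Sum.inr j)))
          (fun j => by rw [hcbf1, Equiv.symm_apply_apply]; rfl) _ hPw
      · exact hsub (W₁' k) (fb₁ k) (fun i => ((k, 1), σ k (Sum.inl i)))
          (fun i => by rw [hcbf1, Equiv.symm_apply_apply]; rfl) _ hQw
  -- the basis
  set cbι := Module.Basis.mk hli hspan with hcbιdef
  refine ⟨cbι, fun kl => κ₀ kl.1 ((σ kl.1).symm kl.2), fun k ℓ => ?_, fun k ℓ => ?_, fun k ℓ h => ?_,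
    fun k ℓ h => ?_, fun k k' i j => ?_, fun k k' t i j => ?_⟩
  · rw [hcbιdef, Module.Basis.mk_apply, hcbf0]; exact heW _ _
  · rw [hcbιdef, Module.Basis.mk_apply, hcbf1]; exact hfW' _ _
  · rw [hcbιdef, Module.Basis.mk_apply, Module.Basis.mk_apply, hcbf0, hcbf1]
    exact he0 _ _ h
  · rw [hcbιdef, Module.Basis.mk_apply, Module.Basis.mk_apply, hcbf0, hcbf1]
    exact he1 _ _ h
  · rw [hcbιdef, Module.Basis.mk_apply, Module.Basis.mk_apply]
    exact hT01 k k' i j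
  · rw [hcbιdef, Module.Basis.mk_apply, Module.Basis.mk_apply]
    rcases CMTheta.fin2_cases t with rfl | rfl
    · exact hT00 k k' i j
    · exact hT11 k k' i j

end CMDualBases

end HodgeStructure

end Literature.AlgebraicGeometry.Motives

end
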